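import Summits.ResolutionOfSingularities.ResolutionOfSingularities.Theorems.EquisingularLiftEquisingularLiftNatLiftableNoseClassDefs
import Summits.ResolutionOfSingularities.ResolutionOfSingularities.Theorems.EquisingularLiftEquisingularLiftNatCompleteIntersectionLiftKey
import Literature.AlgebraicGeometry.Motives.ProjectiveSpaceFieldPoints
import HarnessLib

/-!
# [OURS · L1 W4.5(b) · EL♮(3)] SPECIMEN for the v6‴ rung's `union` constructor — TWO SKEW LINES in `ℙ³_k` form a liftable nose class

Cell `res-hironaka`, rung L, slot W4.5(b); crux **EL♮(3)** (stmt-ResolutionOfSingularities-20148); res-L1-w45b-lead-2's v6‴ rung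
`stub_elnat_liftableNoseThenPoints` over the inductive DOWNSTAIRS class `IsLiftableNoseClass` (…NatLiftableNoseClassDefs p530164:
`ci` / `det` / `union`). OURS; NOT a statement of any manuscript; AI-written, weaker than expert review. No definition, no `sorry`,
standard axioms. `--supports stmt-ResolutionOfSingularities-20148 --as helper`; closes nothing — a NON-VACUITY certificate for the
`union` constructor (res-L1-w45b-plan-1 PLANNER-MEMO-g10-1 census class C0a (β): the double locus of the «two skew double lines» quartics,
e.g. general members of `((x₀,x₁)² (x₂,x₃)²)₄`, is `L₀₁ ∪ L₂₃` — smooth, DISCONNECTED, hence never arithmetically Cohen–Macaulay, so outside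
the v6 CI-nose and v6′ DET-nose rungs; it is in the v6‴ class by `union` of two `ci` lines).

* `line_isLiftableNoseClass` — a coordinate line `V(x_a, x_b)` (`a ≠ b`) of `ℙ³_k` is in the class via `ci` (c = 2, degrees (1,1), the point with
  the two other coordinates `1, 0`, Jacobian minor `∂(x_a,x_b)/∂(x_a,x_b) = 1`);
* **`skewLines_isLiftableNoseClass`** — `V(x₀,x₁) ∪ V(x₂,x₃) ∈ IsLiftableNoseClass k 3` (`union`; the lines are disjoint because no relevant
  prime contains all four variables).

References: R. Hartshorne, *Algebraic Geometry* (1977), I Ex. 2.17, II Prop. 2.5 [Hartshorne1977]; cell: PLANNER-MEMO-g10-1 §1 C0a (OURS, index only).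
-/

set_option linter.dupNamespace false -- mandated namespace `Summit.<Summit>.<Problem>` of this single-conjunct summit

noncomputable section

open CategoryTheory AlgebraicGeometry TopologicalSpace
open MvPolynomial
open Literature.AlgebraicGeometry.Resolution

namespace Summit.ResolutionOfSingularities.ResolutionOfSingularities.Cruxes.EquisingularLiftNat.Sections

namespace SkewLines

variable (k : Type) [Field k]

/-- The coordinate line `V(x_a, x_b) ⊂ ℙ³_k`, as the common zero set of the pair `![X a, X b]` (the `ci` data shape). [folklore] -/
theorem coordLine_eq (a b : Fin (3 + 1)) :
    (letI := MvPolynomial.gradedAlgebra (σ := Fin (3 + 1)) (R := k);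
      {y : (Literature.AlgebraicGeometry.Motives.projectiveSpace 3 k).left |
        ∀ i : Fin 2, (![X a, X b] : Fin 2 → MvPolynomial (Fin (3 + 1)) k) i ∈
          (y : ProjectiveSpectrum (MvPolynomial.homogeneousSubmodule (Fin (3 + 1)) k)).asHomogeneousIdeal}) =
    (letI := MvPolynomial.gradedAlgebra (σ := Fin (3 + 1)) (R := k);
      {y : (Literature.AlgebraicGeometry.Motives.projectiveSpace 3 k).left |
        (X a : MvPolynomial (Fin (3 + 1)) k) ∈ (y : ProjectiveSpectrum (MvPolynomial.homogeneousSubmodule (Fin (3 + 1)) k)).asHomogeneousIdeal ∧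
        (X b : MvPolynomial (Fin (3 + 1)) k) ∈ (y : ProjectiveSpectrum (MvPolynomial.homogeneousSubmodule (Fin (3 + 1)) k)).asHomogeneousIdeal}) := by
  ext y
  simp only [Set.mem_setOf_eq, Fin.forall_fin_two, Matrix.cons_val_zero, Matrix.cons_val_one]

/-- **A coordinate line `V(x_a, x_b)` (`a ≠ b`; `c, d` the two remaining indices) of `ℙ³_k` is in the liftable nose class** via the `ci`
constructor: degrees `(1,1)`, the point `[x_c = 1, others 0]` lies on it, and the Jacobian minor on the columns `(a, b)` is `det 1 = 1 ∉ 𝔮_y`.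
[cite: Hartshorne1977, II Prop. 2.5 and I Ex. 2.17] -/
theorem line_isLiftableNoseClass (a b c : Fin (3 + 1)) (hab : a ≠ b) (hca : c ≠ a) (hcb : c ≠ b) :
    IsLiftableNoseClass k 3 (letI := MvPolynomial.gradedAlgebra (σ := Fin (3 + 1)) (R := k);
      {y : (Literature.AlgebraicGeometry.Motives.projectiveSpace 3 k).left |
        ∀ i : Fin 2, (![X a, X b] : Fin 2 → MvPolynomial (Fin (3 + 1)) k) i ∈
          (y : ProjectiveSpectrum (MvPolynomial.homogeneousSubmodule (Fin (3 + 1)) k)).asHomogeneousIdeal}) := by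
  classical
  letI := MvPolynomial.gradedAlgebra (σ := Fin (3 + 1)) (R := k)
  refine IsLiftableNoseClass.ci 2 ![X a, X b] ![1, 1] ⟨?_, ?_, ?_, ?_⟩
  · -- degrees
    intro i
    fin_cases i
    · exact ⟨le_rfl, isHomogeneous_X k a⟩
    · exact ⟨le_rfl, isHomogeneous_X k b⟩
  · -- a point on the line: homogeneous coordinates `e_c`
    let z : Fin (3 + 1) → k := Pi.single c 1
    have hz : z ≠ 0 := by
      intro h; have := congrFun h c; simp [z] at this
    refine ⟨(Literature.AlgebraicGeometry.Motives.ProjectiveSpace.pointOfVec k z hz).pt, ?_⟩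
    have hmem : ∀ j : Fin (3 + 1), j ≠ c → (X j : MvPolynomial (Fin (3 + 1)) k) ∈
        ((Literature.AlgebraicGeometry.Motives.ProjectiveSpace.pointOfVec k z hz).pt).asHomogeneousIdeal := by
      intro j hj
      by_contra hX
      have h := (Literature.AlgebraicGeometry.Motives.ProjectiveSpace.pt_pointOfVec_mem_basicOpen_X_iff z hz j).mp hX
      exact h (by simp [z, hj])
    rw [coordLine_eq]
    exact ⟨hmem a hca.symm, hmem b hcb.symm⟩
  · -- the Jacobian minor on the columns `(a, b)` is `1`
    intro y _
    let e : Fin 2 ↪ Fin (3 + 1) := ⟨![a, b], by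
      intro i j h
      fin_cases i <;> fin_cases j <;> simp_all [hab.symm]⟩
    refine ⟨e, ?_⟩
    have hM : (Matrix.of fun i j => pderiv (e j) ((![X a, X b] : Fin 2 → MvPolynomial (Fin (3 + 1)) k) i)) = 1 := by
      ext i j
      fin_cases i <;> fin_cases j <;>
        simp [e, pderiv_X, hab, hab.symm]
    rw [hM, Matrix.det_one]
    exact fun h1 => y.isPrime.ne_top ((Ideal.eq_top_iff_one _).mpr h1)
  · -- closed: a common zero set of forms
    have hset : {y : (Literature.AlgebraicGeometry.Motives.projectiveSpace 3 k).left |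
        ∀ i : Fin 2, (![X a, X b] : Fin 2 → MvPolynomial (Fin (3 + 1)) k) i ∈
          (y : ProjectiveSpectrum (MvPolynomial.homogeneousSubmodule (Fin (3 + 1)) k)).asHomogeneousIdeal} =
        ⋂ i : Fin 2, ProjectiveSpectrum.zeroLocus (MvPolynomial.homogeneousSubmodule (Fin (3 + 1)) k)
          {(![X a, X b] : Fin 2 → MvPolynomial (Fin (3 + 1)) k) i} := by
      ext y
      refine ⟨fun hy => Set.mem_iInter.mpr fun i => ?_, fun hy i => ?_⟩
      · change ({(![X a, X b] : Fin 2 → MvPolynomial (Fin (3 + 1)) k) i} : Set (MvPolynomial (Fin (3 + 1)) k)) ⊆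
          ((y : ProjectiveSpectrum (MvPolynomial.homogeneousSubmodule (Fin (3 + 1)) k)).asHomogeneousIdeal : Set _)
        rw [Set.singleton_subset_iff]
        exact hy i
      · have h := Set.mem_iInter.mp hy i
        change ({(![X a, X b] : Fin 2 → MvPolynomial (Fin (3 + 1)) k) i} : Set (MvPolynomial (Fin (3 + 1)) k)) ⊆
          ((y : ProjectiveSpectrum (MvPolynomial.homogeneousSubmodule (Fin (3 + 1)) k)).asHomogeneousIdeal : Set _) at h
        rw [Set.singleton_subset_iff] at h
        exact h
    rw [hset]
    exact isClosed_iInter fun i => ProjectiveSpectrum.isClosed_zeroLocus _ _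

/-- **TWO SKEW LINES `V(x₀,x₁) ∪ V(x₂,x₃) ⊂ ℙ³_k` are in the liftable nose class** (`union` of two `ci` lines; disjoint since a relevant
homogeneous prime cannot contain `x₀, x₁, x₂, x₃`). The double locus of the census class C0a «two skew double lines» (PLANNER-MEMO-g10-1):
smooth but DISCONNECTED, so not ACM — outside the v6/v6′ rungs, inside v6‴. [cite: Hartshorne1977, I Ex. 2.17] -/
theorem skewLines_isLiftableNoseClass :
    IsLiftableNoseClass k 3 ((letI := MvPolynomial.gradedAlgebra (σ := Fin (3 + 1)) (R := k);
      {y : (Literature.AlgebraicGeometry.Motives.projectiveSpace 3 k).left |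
        ∀ i : Fin 2, (![X 0, X 1] : Fin 2 → MvPolynomial (Fin (3 + 1)) k) i ∈
          (y : ProjectiveSpectrum (MvPolynomial.homogeneousSubmodule (Fin (3 + 1)) k)).asHomogeneousIdeal}) ∪
      (letI := MvPolynomial.gradedAlgebra (σ := Fin (3 + 1)) (R := k);
      {y : (Literature.AlgebraicGeometry.Motives.projectiveSpace 3 k).left |
        ∀ i : Fin 2, (![X 2, X 3] : Fin 2 → MvPolynomial (Fin (3 + 1)) k) i ∈
          (y : ProjectiveSpectrum (MvPolynomial.homogeneousSubmodule (Fin (3 + 1)) k)).asHomogeneousIdeal})) := by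
  letI := MvPolynomial.gradedAlgebra (σ := Fin (3 + 1)) (R := k)
  refine IsLiftableNoseClass.union _ _
    (line_isLiftableNoseClass k 0 1 2 (by decide) (by decide) (by decide))
    (line_isLiftableNoseClass k 2 3 0 (by decide) (by decide) (by decide)) ?_
  rw [coordLine_eq, coordLine_eq, Set.eq_empty_iff_forall_notMem]
  rintro y ⟨⟨h0, h1⟩, ⟨h2, h3⟩⟩
  apply y.not_irrelevant_le
  refine toIdeal_le_toIdeal_iff.mp ((Summit.ResolutionOfSingularities.ResolutionOfSingularities.Cruxes.EquisingularLift.StrataSplit.irrelevant_le_span 3 k).trans (Ideal.span_le.mpr ?_))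
  rintro _ ⟨i, rfl⟩
  fin_cases i
  · exact h0
  · exact h1
  · exact h2
  · exact h3

end SkewLines

end Summit.ResolutionOfSingularities.ResolutionOfSingularities.Cruxes.EquisingularLiftNat.Sections

end
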